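import Literature.NumberTheory.EllipticCurves.TianYuanZhang2017.CMPointFrobeniusTwoValueDisplays
import HarnessLib

/-!
# Tian–Yuan–Zhang 2017 §3.1, the DEFINITION of the composite field `ℍ′_n := L_n(i)·∏_{d₀ ∣ n, d₀ ≡ 5, 6 (mod 8)} H′_{d₀}`, AS PRINTED:
# `ℍ′_n` is GENERATED by `L_n(i)` and the ring class fields `H′_{d₀}` of its blocks — DISPLAY (one new named fact, refining
# `tyz_cmPointRingClassFrobeniusValueData₂`); and, PROVED from it: for `n` WITHOUT blocks (`n ≡ 7 (mod 8)`, no divisor `≡ 5 (mod 8)`)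
# `ℍ′_n = L_n(i)` — every automorphism trivial on `L_n(i)` is the identity, and `Gal(ℍ′_n/ℚ)` is COMMUTATIVE

Companion to `GenusPointDescentDisplays.lean` (`structure GenusPointData n`: the number field `D.H = ℍ′_n ∋ i, √−d`, Galois over `ℚ`, with the
genus points), `CMPointGaloisDisplays.lean` / `CMPointRingClassDisplays.lean` / `CMPointFrobenius{,Four,Value,TwoValue}Displays.lean` (the CM-point
layer: for every block `d ∣ n`, `d ≡ 5, 6 (mod 8)`, the subgroups `Gal(ℍ′_n/H_d) ⊇ Gal(ℍ′_n/H′_d)` of `Gal(ℍ′_n/ℚ) = (D.H ≃ₐ[ℚ] D.H)`, the ring class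
dictionaries `ρ₂`, `ρ₄`, the Frobenius elements and their classes).  Those files display LOWER bounds on `ℍ′_n` (it contains `i`, the `√−d`, the CM
points, and automorphisms with prescribed actions exist); none of them records the sentence that `ℍ′_n` is NOT LARGER than the compositum the
source defines it to be.  THIS file displays exactly that sentence, in the Galois-theoretic currency the other displays use (subgroups of
`D.H ≃ₐ[ℚ] D.H`): **(C) an automorphism of `ℍ′_n` that is trivial on `L_n(i) = ℚ(i, √d : d ∣ n)` and lies in `Gal(ℍ′_n/H′_{d₀})` for every block
`d₀` is the identity** — by the Galois correspondence (`ℍ′_n/ℚ` Galois; a compositum of subfields is the fixed field of the intersection of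
their fixing groups) this is the sentence "`ℍ′_n := L_n(i)·∏ H′_{d₀}`" read on the named objects, no more and no less.  Requested by no one; typed by
the LEAD of crux stmt-BirchSwinnertonDyer-20509 (cruxlead-20509 g16) as the ONE missing display for the visibility theorem
`Summits/BirchSwinnertonDyer/BirchSwinnertonDyer/Theorems/PrintCf2RamifiedOffTYZLowerHalfVisibleSeven.lean` (the lower half of C⁺ on special
generators of the block-free family, where (C) gives `ℍ′_n = L_n(i)`, an ABELIAN field, so that a Galois-norm argument bounds the square classes
of `ℚ(i)` that die in `ℍ′_n`).  HONEST FRAMING: §1–§3 are a display (one predicate for one printed sentence, read on named objects) and ONE named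
fact refining `tyz_cmPointRingClassFrobeniusValueData₂` (the refinement is proved in §4, so every earlier `tyz_cmPoint…Data` follows from the new
name); nothing in §1–§3 is asserted (no `_holds`), no count moves; consumers take `(h : tyz_cmPointCompositumData)` as an explicit hypothesis.  Net
debt of this file: +1 (a display of a printed DEFINITION; no research content).  Cell `bsd-print-cf2`, LEAD seat cruxlead-20509 g16.  BSD is not
proved by any of this; no class is closed by this file.

## THE PRINT

* [TianYuanZhang2017] **§3.1** (arXiv:1411.4728 chunk p0011 L58–L66; J739): "To compare `Z(d₀)` for different divisors `d₀` of `n`, we introduce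
  the composite field `ℍ′_n := L_n(i)·∏_{d₀ ∣ n, d₀ > 0, d₀ ≡ 5, 6 (mod 8)} H′_{d₀} ⊂ ℚ̄`.  Here `L_n(i) = ℚ(i, √d : d ∣ n)`.  The field seems to be very
  large, but we will see that `A(ℍ′_n)_tor ⊂ A[4]` in Lemma 3.18, which is a key property in our treatment.  Note that `A(ℍ′_n)` is a
  `ℤ[i]`-module.  Define `P(n) ∈ A(ℍ′_n)` inductively by …"; **Prop. 3.2 (3)** (p0010 L112; J738): "Assume that `n ≡ 7 (mod 8)`. Then `H′_n = H_n`";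
  proof of Lemma 3.21 (p0020 L55–L63; J759): "the subfield of `H′_n` fixed by `2Cl′_n` is `L_n, L_n(i), L_n` according to `n ≡ 5, 6, 7 (mod 8)`.
  The field `L_n(i) = ℚ(i, √d : d ∣ n)`. … In the case `n ≡ 7 (mod 8)`, `H′_n = H_n` and thus `Z(n)` is already defined over `L_n`."
* Galois theory behind the word "composite field" (Lang, *Algebra*, VI §1, Thm. 1.2 and Cor. 1.4; Mathlib `IsGalois.intermediateFieldEquivSubgroup`,
  `IntermediateField.fixingSubgroup_sup`): for a finite Galois extension `M/ℚ` and subfields `F₁, …, F_r ⊂ M`, the compositum `F₁⋯F_r` is the fixed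
  field of `⋂ᵢ Gal(M/Fᵢ)`; hence `M = F₁⋯F_r` iff `⋂ᵢ Gal(M/Fᵢ) = {1}`.

## WHAT IS DISPLAYED, AND WHY IT IS A FAITHFUL READING

On `D : GenusPointData n` with the objects `ΓH' d = Gal(ℍ′_n/H′_d)` of `CMPointRingClassPrinted` / `CMPointRingClassFrobeniusValuePrinted₂` (by
(RC1) of `RingClassTwoBlockSpec` / `RingClassFourBlockSpec`, `ΓH' d` is the KERNEL of the dictionary `ρ_d : Gal(ℍ′_n/K_d) ↠ Gal(H′_d/K_d) ≅ Pic(𝒪_f)`,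
i.e. exactly the subgroup fixing `H′_d`) and `TrivialOnL D n g` = «`g` is trivial on `L_n(i) = ℚ(i, √d : d ∣ n)`» (J759), the predicate
`CompositumSpec D ΓH'` says: **every `g ∈ Gal(ℍ′_n/ℚ)` with `g|_{L_n(i)} = 1` and `g ∈ Gal(ℍ′_n/H′_{d₀})` for all `d₀ ∣ n`, `d₀ ≡ 5, 6 (mod 8)`, is
`1`** — the definition "`ℍ′_n := L_n(i)·∏ H′_{d₀}`" (p0011 L60–L62) under the Galois correspondence.  It is packaged, on the SAME data
`(z, Φ, ΓH, ΓH', σ, θ, c, ρ₂, ρ₄)` as all earlier conjuncts, in `CMPointCompositumPrinted`, and the named fact `tyz_cmPointCompositumData` asserts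
that TYZ's data satisfy `Printed ∧ CMPointCompositumPrinted` — true of the source's own `ℍ′_n` with `ΓH' d := Gal(ℍ′_n/H′_d)`, the witnesses for
which every earlier conjunct was read.  NOT displayed: any degree / class-number value, the structure of `Gal(H′_d/ℚ)` beyond (G3)/(G5), the
fields `H_{d,4} ∌` of odd `n`.

## PROVED CONSEQUENCES (§4)

* `tyz_cmPointRingClassFrobeniusValueData₂_of_compositumData` (drop (C)): the new name feeds every consumer of the earlier names.
* `CompositumSpec.eq_one_of_trivialOnL` — if `n` has NO block (`∀ d ∣ n, d ≢ 5, 6 (mod 8)`; for square-free `n ≡ 5, 6, 7 (mod 8)` this is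
  `n ≡ 7 (mod 8)` with no divisor `≡ 5 (mod 8)`, i.e. every prime factor `≡ 1, 7 (mod 8)`), then every automorphism trivial on `L_n(i)` is `1`
  (`ℍ′_n = L_n(i)`: Prop. 3.2 (3) "`H′_n = H_n`", J759 "thus `Z(n)` is already defined over `L_n`");
* `CompositumSpec.commute_of_noBlock` — then any two automorphisms of `ℍ′_n` COMMUTE (a commutator fixes `i` and every `√−d`, whose squares are
  rational), i.e. `Gal(ℍ′_n/ℚ)` is abelian (`L_n(i)` is multiquadratic).

References: [TianYuanZhang2017] §3.1 (p0011 L58–L73), Prop. 3.2 (3) (p0010 L112), proof of Lemma 3.21 (p0020 L55–L63); S. Lang, *Algebra*, rev. 3rd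
ed., GTM 211, VI §1 Thm. 1.2, Cor. 1.4 [Lang2002]; the cell note
`Summits/BirchSwinnertonDyer/BirchSwinnertonDyer/Cruxes/RamifiedOffTYZOfFacts/Lines/offtyz_v7_Visibility.md` (cruxlead-20509 g16).
-/

noncomputable section

open scoped Classical

open WeierstrassCurve Finset

namespace Literature.NumberTheory.EllipticCurves.TianYuanZhang2017

open Literature.NumberTheory.QuadraticFields.RingClass

namespace GenusPointData

variable {n : ℕ}

/-! ## §1 The printed sentence: `ℍ′_n` is the compositum of `L_n(i)` and the `H′_{d₀}` -/

/-- **(C) "`ℍ′_n := L_n(i)·∏_{d₀ ∣ n, d₀ ≡ 5, 6 (mod 8)} H′_{d₀}`"** read under the Galois correspondence on the objects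
`ΓH' d₀ = Gal(ℍ′_n/H′_{d₀})`: an automorphism of `ℍ′_n` that is trivial on `L_n(i) = ℚ(i, √d : d ∣ n)` and fixes every `H′_{d₀}` (lies in
`ΓH' d₀` for every block `d₀`) is the identity.  A predicate; nothing asserted.
[cite: TianYuanZhang2017, §3.1 (p0011 L58–L66) and proof of Lemma 3.21 (p0020 L55–L63)] [cite: Lang2002, VI §1 Thm. 1.2, Cor. 1.4] -/
def CompositumSpec (D : GenusPointData n) (ΓH' : ℕ → Subgroup (D.H ≃ₐ[ℚ] D.H)) : Prop :=
  ∀ g : D.H ≃ₐ[ℚ] D.H, D.TrivialOnL n g → (∀ d ∈ n.divisors, (d % 8 = 5 ∨ d % 8 = 6) → g ∈ ΓH' d) → g = 1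

/-! ## §2 The CM-point layer with the ring class dictionaries, the Frobenius data, AND the compositum sentence on the SAME subgroups -/

/-- **Tian–Yuan–Zhang §3.1–3.2 / Prop. 3.2 / Thm. 3.6 / p. 759 on the data `D`, all blocks, WITH the ring class dictionaries, the Frobenius
elements and their classes (exactly `CMPointRingClassFrobeniusValuePrinted₂`), AND the compositum sentence (C) on the SAME subgroups
`Gal(ℍ′_n/H′_{d₀})`**.  A predicate; nothing asserted.
[cite: TianYuanZhang2017, §3.1 (J738–J739 = p0011 L1–L73), Prop. 3.2 (1)(2)(3) (p0010 L106–L113), Thm. 3.6 (1)(2) (J741), proof of Lemma 3.15 (J750), proof of Lemma 3.21 (J759), §2.1 (J725)]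
[cite: Cox2013, Thm. 6.1, Lemma 9.3, §5.C Lemma 5.19, (5.22), Thm. 5.23, Cor. 5.25, §9.A (PDF pp. 192–193), §7.D Thm. 7.24 and (7.25)–(7.27)] -/
def CMPointCompositumPrinted (D : GenusPointData n) : Prop :=
  ∃ (z : ℕ → APoint D.H) (Φ : ℕ → Finset (D.H ≃ₐ[ℚ] D.H)) (ΓH ΓH' : ℕ → Subgroup (D.H ≃ₐ[ℚ] D.H))
    (σ θ : ℕ → (D.H ≃ₐ[ℚ] D.H)) (c : D.H ≃ₐ[ℚ] D.H)
    (ρ₂ : (d : ℕ) → (D.galK d →* RingClassGroup (GenusField d) 2))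
    (ρ₄ : (d : ℕ) → (D.galK d →* RingClassGroup (GenusField d) 4)),
    D.ConjSpec c ∧
    (∀ d ∈ n.divisors,
      ((d % 8 = 5 ∨ d % 8 = 6) → D.CMBlockSpec d (z d) (Φ d) (ΓH d) (ΓH' d) (σ d) c) ∧
      (d % 8 = 6 → D.ThetaBlockSpec d (z d) (ΓH d) (ΓH' d) (σ d) (θ d)) ∧
      (d % 8 = 7 → D.SevenBlockSpec d) ∧
      (d % 8 = 5 → D.RingClassTwoBlockSpec d (ΓH d) (ΓH' d) (ρ₂ d)) ∧
      (d % 8 = 6 → D.RingClassFourBlockSpec d (ΓH d) (ΓH' d) (ρ₄ d)) ∧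
      (d % 8 = 5 → D.FrobeniusTwoBlockSpec d (ΓH' d)) ∧
      (d % 8 = 6 → D.FrobeniusFourBlockSpec d (ΓH' d)) ∧
      (d % 8 = 6 → D.FrobeniusFourValueBlockSpec d (ΓH' d) (ρ₄ d)) ∧
      (d % 8 = 5 → D.FrobeniusTwoValueBlockSpec d (ΓH' d) (ρ₂ d))) ∧
    D.CompositumSpec ΓH'

end GenusPointData

/-! ## §3 The ONE named fact -/

/-- **Tian–Yuan–Zhang 2017, §3 with the CM-point layer, the ring class dictionaries of Prop. 3.2 (1)(2), the Frobenius elements of the ramified odd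
primes of the blocks and their classes, AND the definition of `ℍ′_n` as the compositum `L_n(i)·∏_{d₀ ≡ 5, 6} H′_{d₀}` (§3.1, p0011 L60–L62), AS
PRINTED, as ONE named fact**: for every positive square-free `n ≡ 5, 6, 7 (mod 8)` there are data `D : GenusPointData n` satisfying
`GenusPointData.Printed` and `GenusPointData.CMPointCompositumPrinted`.  Constructed in the source from the CM points on `X_U → A` (§3.1–3.2),
Yuan–Zhang–Zhang's Gross–Zagier formula (Thm. 3.3) and class field theory, with `ℍ′_n` the compositum BY DEFINITION; no `_holds` expected.  Refines
`tyz_cmPointRingClassFrobeniusValueData₂` (drop (C); proved below), hence every earlier `tyz_cmPoint…Data`.  Consumers take it as an explicit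
hypothesis; nothing is asserted here.
[cite: TianYuanZhang2017, §3: §3.1 (J738–J739 = p0011 L1–L73, esp. L58–L66), Prop. 3.2 (1)(2)(3) (p0010 L106–L113), Prop. 3.4, Thm. 3.5, Thm. 3.6 (J741), Lemma 3.18, Lemma 3.21 and its proof (J759 = p0020 L50–L63), proof of Lemma 3.15 (J750), §2.1 (J725)]
[cite: Cox2013, §5.C Lemma 5.19, (5.20), (5.22), Thm. 5.23, Cor. 5.25; §6.A Thm. 6.1; §7.C; §9.A with (9.1); §7.D Thm. 7.24 and (7.25)–(7.27); Prop. 7.22; Lemma 9.3]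
[cite: Lang2002, VI §1 Thm. 1.2, Cor. 1.4] -/
def tyz_cmPointCompositumData : Prop :=
  ∀ (n : ℕ), Squarefree n → (n % 8 = 5 ∨ n % 8 = 6 ∨ n % 8 = 7) →
    ∃ D : GenusPointData n, D.Printed ∧ D.CMPointCompositumPrinted

/-! ## §4 Proved consequences: the refinement, and the block-free case `ℍ′_n = L_n(i)` (trivial kernel, commutative Galois group) -/

namespace GenusPointData

variable {n : ℕ}

/-- The compositum-level CM-point layer implies the two-conductor class-level one (`CMPointRingClassFrobeniusValuePrinted₂`: drop (C)).
[cite: TianYuanZhang2017, §3.1–3.2, Prop. 3.2 (1)(2) (p0010 L106–L113)] -/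
theorem CMPointCompositumPrinted.valuePrinted₂ {D : GenusPointData n} (h : D.CMPointCompositumPrinted) :
    D.CMPointRingClassFrobeniusValuePrinted₂ := by
  obtain ⟨z, Φ, ΓH, ΓH', σ, θ, c, ρ₂, ρ₄, hc, hb, -⟩ := h
  exact ⟨z, Φ, ΓH, ΓH', σ, θ, c, ρ₂, ρ₄, hc, hb⟩

/-- An automorphism of `ℍ′_n` maps `i` to `±i`. [cite: TianYuanZhang2017, §3.1 (p0011 L64: i ∈ L_n(i) ⊂ ℍ′_n)] -/
theorem algEquiv_im_eq_or (D : GenusPointData n) (g : D.H ≃ₐ[ℚ] D.H) : g D.im = D.im ∨ g D.im = -D.im := by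
  have h2 : (g D.im) ^ 2 = D.im ^ 2 := by rw [← map_pow, D.im_sq, map_neg, map_one]
  have h0 : (g D.im - D.im) * (g D.im + D.im) = 0 := by linear_combination h2
  rcases mul_eq_zero.mp h0 with h | h
  · exact Or.inl (by linear_combination h)
  · exact Or.inr (by linear_combination h)

/-- An automorphism of `ℍ′_n` maps `√−d` (`d ∣ n`) to `±√−d`. [cite: TianYuanZhang2017, §3.1 (p0011 L64: K_d ⊂ L_n(i) ⊂ ℍ′_n)] -/
theorem algEquiv_sqrtNeg_eq_or (D : GenusPointData n) {d : ℕ} (hd : d ∈ n.divisors) (g : D.H ≃ₐ[ℚ] D.H) :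
    g (D.sqrtNeg d) = D.sqrtNeg d ∨ g (D.sqrtNeg d) = -D.sqrtNeg d := by
  have h2 : (g (D.sqrtNeg d)) ^ 2 = (D.sqrtNeg d) ^ 2 := by
    rw [← map_pow, D.sqrtNeg_sq d hd, map_neg, map_natCast]
  have h0 : (g (D.sqrtNeg d) - D.sqrtNeg d) * (g (D.sqrtNeg d) + D.sqrtNeg d) = 0 := by linear_combination h2
  rcases mul_eq_zero.mp h0 with h | h
  · exact Or.inl (by linear_combination h)
  · exact Or.inr (by linear_combination h)

/-- If `g x = a·x` with `a = ±1`, then also `g⁻¹ x = a·x`. [folklore] -/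
private theorem algEquiv_inv_apply_of_apply_eq_sign (D : GenusPointData n) (g : D.H ≃ₐ[ℚ] D.H) {x a : D.H} (ha : a = 1 ∨ a = -1)
    (hx : g x = a * x) : g⁻¹ x = a * x := by
  have haa : a * a = 1 := by rcases ha with rfl | rfl <;> norm_num
  have hga : g a = a := by rcases ha with rfl | rfl <;> simp
  have e : g (a * x) = x := by rw [map_mul, hga, hx, ← mul_assoc, haa, one_mul]
  have e' : g⁻¹ (g (a * x)) = a * x := by rw [← AlgEquiv.mul_apply, inv_mul_cancel, AlgEquiv.one_apply]
  rw [e] at e'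
  exact e'

/-- An element on which `g` and `h` both act by a sign is FIXED by the commutator `g h g⁻¹ h⁻¹`. [folklore] -/
private theorem commutator_apply_eq_of_sign (D : GenusPointData n) (g h : D.H ≃ₐ[ℚ] D.H) {x a b : D.H} (ha : a = 1 ∨ a = -1)
    (hb : b = 1 ∨ b = -1) (hgx : g x = a * x) (hhx : h x = b * x) : (g * h * g⁻¹ * h⁻¹) x = x := by
  have haa : a * a = 1 := by rcases ha with rfl | rfl <;> norm_num
  have hbb : b * b = 1 := by rcases hb with rfl | rfl <;> norm_num
  have hga : g a = a := by rcases ha with rfl | rfl <;> simp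
  have hgb : g b = b := by rcases hb with rfl | rfl <;> simp
  have hha : h a = a := by rcases ha with rfl | rfl <;> simp
  have hhb : h b = b := by rcases hb with rfl | rfl <;> simp
  have hg'b : g⁻¹ b = b := by rcases hb with rfl | rfl <;> simp
  have hg' := algEquiv_inv_apply_of_apply_eq_sign D g ha hgx
  have hh' := algEquiv_inv_apply_of_apply_eq_sign D h hb hhx
  have e2 : g⁻¹ (h⁻¹ x) = b * (a * x) := by rw [hh', map_mul, hg'b, hg']
  have e3 : h (g⁻¹ (h⁻¹ x)) = b * (a * (b * x)) := by rw [e2, map_mul, hhb, map_mul, hha, hhx]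
  have e4 : g (h (g⁻¹ (h⁻¹ x))) = b * (a * (b * (a * x))) := by
    rw [e3, map_mul, hgb, map_mul, hga, map_mul, hgb, hgx]
  rw [AlgEquiv.mul_apply, AlgEquiv.mul_apply, AlgEquiv.mul_apply, e4]
  linear_combination (b * b * x) * haa + x * hbb

/-- The sign of an automorphism on `i`, as an element `a = ±1` with `g i = a·i`. [cite: TianYuanZhang2017, §3.1 (p0011 L64)] -/
theorem exists_sign_im (D : GenusPointData n) (g : D.H ≃ₐ[ℚ] D.H) : ∃ a : D.H, (a = 1 ∨ a = -1) ∧ g D.im = a * D.im := by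
  rcases D.algEquiv_im_eq_or g with h | h
  · exact ⟨1, Or.inl rfl, by rw [one_mul, h]⟩
  · exact ⟨-1, Or.inr rfl, by rw [neg_one_mul, h]⟩

/-- The sign of an automorphism on `√−d` (`d ∣ n`), as an element `a = ±1`. [cite: TianYuanZhang2017, §3.1 (p0011 L64)] -/
theorem exists_sign_sqrtNeg (D : GenusPointData n) {d : ℕ} (hd : d ∈ n.divisors) (g : D.H ≃ₐ[ℚ] D.H) :
    ∃ a : D.H, (a = 1 ∨ a = -1) ∧ g (D.sqrtNeg d) = a * D.sqrtNeg d := by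
  rcases D.algEquiv_sqrtNeg_eq_or hd g with h | h
  · exact ⟨1, Or.inl rfl, by rw [one_mul, h]⟩
  · exact ⟨-1, Or.inr rfl, by rw [neg_one_mul, h]⟩

/-- A COMMUTATOR `g h g⁻¹ h⁻¹` of automorphisms of `ℍ′_n` is trivial on `L_n(i)`: each of `g, h` acts on `i` and on every `√−d` (`d ∣ n`) by a
sign. [cite: TianYuanZhang2017, §3.1 (p0011 L64: L_n(i) = ℚ(i, √d : d ∣ n))] -/
theorem trivialOnL_commutator (D : GenusPointData n) (g h : D.H ≃ₐ[ℚ] D.H) : D.TrivialOnL n (g * h * g⁻¹ * h⁻¹) := by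
  refine ⟨?_, fun d hd _ => ?_⟩
  · obtain ⟨a, ha, hga⟩ := D.exists_sign_im g
    obtain ⟨b, hb, hhb⟩ := D.exists_sign_im h
    exact commutator_apply_eq_of_sign D g h ha hb hga hhb
  · obtain ⟨a, ha, hga⟩ := D.exists_sign_sqrtNeg hd g
    obtain ⟨b, hb, hhb⟩ := D.exists_sign_sqrtNeg hd h
    exact commutator_apply_eq_of_sign D g h ha hb hga hhb

/-- **Block-free `n`: `ℍ′_n = L_n(i)`.**  If no divisor of `n` is `≡ 5, 6 (mod 8)` (for square-free `n ≡ 5, 6, 7 (mod 8)`: `n ≡ 7 (mod 8)` with every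
prime factor `≡ 1, 7 (mod 8)`), the compositum sentence (C) says that every automorphism of `ℍ′_n` trivial on `L_n(i)` is the identity
(Prop. 3.2 (3) "`H′_n = H_n`"; J759 "`Z(n)` is already defined over `L_n`"). [cite: TianYuanZhang2017, §3.1 (p0011 L58–L66), Prop. 3.2 (3) (p0010 L112), proof of Lemma 3.21 (p0020 L55–L63)] -/
theorem CompositumSpec.eq_one_of_noBlock {D : GenusPointData n} {ΓH' : ℕ → Subgroup (D.H ≃ₐ[ℚ] D.H)} (hC : D.CompositumSpec ΓH')
    (hnb : ∀ d ∈ n.divisors, d % 8 ≠ 5 ∧ d % 8 ≠ 6) (g : D.H ≃ₐ[ℚ] D.H) (hg : D.TrivialOnL n g) : g = 1 :=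
  hC g hg fun d hd h56 => absurd h56 (by rcases hnb d hd with ⟨h5, h6⟩; tauto)

/-- **Block-free `n`: `Gal(ℍ′_n/ℚ)` is commutative** (a commutator is trivial on `L_n(i)`, hence trivial). [cite: TianYuanZhang2017, §3.1 (p0011 L58–L66), Prop. 3.2 (3) (p0010 L112)] [cite: Lang2002, VI §1 Cor. 1.4] -/
theorem CompositumSpec.commute_of_noBlock {D : GenusPointData n} {ΓH' : ℕ → Subgroup (D.H ≃ₐ[ℚ] D.H)} (hC : D.CompositumSpec ΓH')
    (hnb : ∀ d ∈ n.divisors, d % 8 ≠ 5 ∧ d % 8 ≠ 6) (g h : D.H ≃ₐ[ℚ] D.H) : g * h = h * g := by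
  have h1 : g * h * g⁻¹ * h⁻¹ = 1 := hC.eq_one_of_noBlock hnb _ (D.trivialOnL_commutator g h)
  calc g * h = (g * h * g⁻¹ * h⁻¹) * (h * g) := by group
    _ = h * g := by rw [h1, one_mul]

end GenusPointData

end Literature.NumberTheory.EllipticCurves.TianYuanZhang2017

end
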